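import Literature.NumberTheory.Transcendental.DownSetTailDecay
import Literature.NumberTheory.Transcendental.SemialgebraicGrounding
import Literature.NumberTheory.Transcendental.FiniteVolumeElementary
import Literature.NumberTheory.Transcendental.PeriodConjectureProofs
import HarnessLib

/-!
# Yoshinaga's theorem: real periods are elementary and computable real numbers

Discharge of the four Yoshinaga facts of `PeriodConjecture.lean` (family `periods`, **periods.S08**):

* `isElementaryReal_of_isRealPeriod_holds` — every real Kontsevich–Zagier period is an
  elementary real number [Yoshinaga 2008, arXiv:0805.0349, Thm. 18 (Thm. 1.1 of the statement
  file); Tent–Ziegler 2010, Cor. 1.2];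
* `isComputableReal_of_isRealPeriod_holds` — hence (and directly) a computable real number;
* `isComputableComplex_of_isPeriod_holds` — periods are computable complex numbers;
* `exists_isComputableReal_not_isRealPeriod_holds` — there is a computable real number which is
  not a period (Yoshinaga's corollary, §3.1, with the computable non-elementary real of Prop. 17).

## The proof

The tree's definition `IsRealPeriod x` is the naive one of Kontsevich–Zagier: `x = ∫_σ p/q`, an
absolutely convergent integral over a `ℚ`-semialgebraic `σ ⊆ ℝⁿ`, domain and integrand possibly
unbounded. Every printed proof of Yoshinaga's theorem first makes both bounded — Yoshinaga's
Lemma 24 (Belkale–Brosnan's description of periods and Hironaka's rectilinearization),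
Tent–Ziegler's Cor. 6.4, Viu-Sos' semi-canonical reduction [Viu-Sos 2021, Thm. 1.1] — i.e. uses
resolution of singularities, which is not available in the tree in a form applicable to real
semialgebraic integrals. The proof assembled here avoids it:

1. `x = vol(E₊) − vol(E₋)` for two `ℚ`-semialgebraic sets `E± ⊆ ℝⁿ⁺¹` of *finite* volume, the strict
   subgraphs of `(p/q)^±` ("the integral is the area under the graph";
   `KZ.IntegralRep.exists_value_eq_volume_sub`, `FiniteVolumeElementary.lean`).
2. **Grounding** (`SemialgebraicGrounding.lean`): each `E±` has the volume of a `ℚ`-semialgebraic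
   coordinatewise down-set `D±` of the open positive orthant (replace fibres by intervals
   `(0, length)`, one coordinate after the other; fibre lengths are first-order by the uniform
   finiteness of the switching points and Tarski–Seidenberg; volumes agree by Cavalieri).
3. **Tail decay** (`DownSetTailDecay.lean`): a finite-volume `ℚ`-semialgebraic down-set satisfies
   `vol(D ∖ B(0, R)) ≤ C R^{-a}` with `a > 0` — an elementary argument (disjoint boxes force the
   box-volume profile `M(r) → 0`; the frontier of the semialgebraic plane set
   `{(r, z) | ∃ x ∈ D, r ≤ max xᵢ, z ≤ ∏ xᵢ}` lies on an algebraic curve `Q = 0`, and a two-term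
   domination argument for the zeros of `Q` turns `M → 0` into `M(r) ≤ C r^{-α}`; a Markov-power
   bound with Fubini and a dyadic decomposition give the tail), replacing for this class of sets
   the general tail estimate of tame integration theory (Lion–Rolin; Cluckers–Miller 2011,
   Prop. 1.5), which the tree's `FiniteVolumeComputable.lean` / `FiniteVolumeElementary.lean`
   take as hypothesis.
4. The exhaustion theorems of those two files (`SemialgVolume.isComputableReal_volume_of_tailDecay`,
   `Yoshinaga.isElementaryReal_volume_of_tailDecay`: dyadic cube counts decided by
   Tarski–Seidenberg are primitive recursive / Kalmár elementary, the localised gaps tend to `0`,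
   Yoshinaga §§3.3–3.6) then give `vol(D±)`, hence `x`, elementary and computable; the corollary is
   the tree's `exists_isComputableReal_not_isRealPeriod_of_isElementaryReal_of_isRealPeriod`.

## Main statements

* `isComputableReal_volume_of_isSemialgebraic`, `isElementaryReal_volume_of_isSemialgebraic` —
  every `ℚ`-semialgebraic subset of `ℝⁿ⁺¹` of finite volume has computable, indeed elementary,
  volume.
* `KZ.IntegralRep.isElementaryReal_value`, `KZ.IntegralRep.isComputableReal_value` — values of
  integral representations of the KZ calculus are elementary / computable reals.
* `isElementaryReal_of_isRealPeriod_holds`, `isComputableReal_of_isRealPeriod_holds`,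
  `isComputableComplex_of_isPeriod_holds`, `exists_isComputableReal_not_isRealPeriod_holds`.

## References

* M. Yoshinaga, *Periods and elementary real numbers*, arXiv:0805.0349 (2008), §3.1 Thm. 18 and
  its corollary, §3.2 Lemma 24, §§3.3–3.6, §2.3 Prop. 17.
* K. Tent, M. Ziegler, *Computable functions of reals*, Münster J. Math. 3 (2010), 43–66,
  Cor. 1.2, Cor. 6.4.
* J. Viu-Sos, *A semi-canonical reduction for periods of Kontsevich–Zagier*, Int. J. Number Theory
  17 (2021), 147–174, Thm. 1.1.
* R. Cluckers, D. J. Miller, *Stability under integration of sums of products of real globally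
  subanalytic functions and their logarithms*, Duke Math. J. 156 (2011), Prop. 1.5.
* M. Kontsevich, D. Zagier, *Periods* (2001), §1.1.

## Design notes

* Theorems only; no definitions, no named facts. The four discharges have exactly the types of the
  named facts of `PeriodConjecture.lean`.
-/

noncomputable section

open MeasureTheory Set
open scoped ENNReal
open Literature.ModelTheory.ExponentialFields Literature.Computability.Complexity

namespace Literature.NumberTheory.Transcendental

/-- **Polynomial tail decay up to grounding.** Every `ℚ`-semialgebraic `E ⊆ ℝ^{n+1}` has the
volume of a `ℚ`-semialgebraic finite-or-infinite-volume down-set `D` of the open positive orthant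
(`Grounding.exists_downset_volume_eq`), and if `vol E < ∞` that down-set has polynomially
decaying tails (`DownSetTail.exists_volume_diff_ball_le`). [folklore] -/
theorem exists_downset_tailDecay {n : ℕ} {E : Set (Fin (n + 1) → ℝ)} (hE : IsSemialgebraic ℚ E)
    (hfin : volume E ≠ ⊤) :
    ∃ D : Set (Fin (n + 1) → ℝ), IsSemialgebraic ℚ D ∧ volume D = volume E ∧
      ∃ C a : ℝ, 0 < a ∧ ∀ R : ℝ, 1 ≤ R →
        volume (D \ Metric.ball 0 R) ≤ ENNReal.ofReal (C * R ^ (-a)) := by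
  obtain ⟨D, hD, hpos, hdown, hvol⟩ := Grounding.exists_downset_volume_eq hE
  have hfinD : volume D ≠ ⊤ := by rwa [hvol]
  obtain ⟨C, a, ha, htail⟩ := DownSetTail.exists_volume_diff_ball_le hD hpos hdown hfinD
  exact ⟨D, hD, hvol, C, a, ha, htail⟩

/-- **Finite-volume `ℚ`-semialgebraic sets have computable volume** (all of them, bounded or
not): ground to a down-set of the same volume, whose tails decay polynomially, and apply
`SemialgVolume.isComputableReal_volume_of_tailDecay`. [folklore] -/
theorem isComputableReal_volume_of_isSemialgebraic {n : ℕ} {E : Set (Fin (n + 1) → ℝ)}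
    (hE : IsSemialgebraic ℚ E) (hfin : volume E ≠ ⊤) : IsComputableReal (volume E).toReal := by
  obtain ⟨D, hD, hvol, C, a, ha, htail⟩ := exists_downset_tailDecay hE hfin
  have hfinD : volume D ≠ ⊤ := by rwa [hvol]
  have := SemialgVolume.isComputableReal_volume_of_tailDecay hD hfinD ha htail
  rwa [hvol] at this

/-- **Finite-volume `ℚ`-semialgebraic sets have elementary volume** (Yoshinaga 2008, §3.6 for
bounded sets; here for all sets of finite volume): ground to a down-set of the same volume, whose
tails decay polynomially, and apply `Yoshinaga.isElementaryReal_volume_of_tailDecay`.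
[cite: Yoshinaga2008, Lemma 29] -/
theorem isElementaryReal_volume_of_isSemialgebraic {n : ℕ} {E : Set (Fin (n + 1) → ℝ)}
    (hE : IsSemialgebraic ℚ E) (hfin : volume E ≠ ⊤) : IsElementaryReal (volume E).toReal := by
  obtain ⟨D, hD, hvol, C, a, ha, htail⟩ := exists_downset_tailDecay hE hfin
  have hfinD : volume D ≠ ⊤ := by rwa [hvol]
  have := Yoshinaga.isElementaryReal_volume_of_tailDecay hD hfinD ha htail
  rwa [hvol] at this

namespace KZ.IntegralRep

variable {n : ℕ}

/-- **Every integral representation of the KZ calculus has an elementary value** (unbounded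
domain and integrand allowed): its value is `vol(E₊) − vol(E₋)` for two finite-volume
`ℚ`-semialgebraic sets (`exists_value_eq_volume_sub`). [cite: Yoshinaga2008, Thm. 18] -/
theorem isElementaryReal_value (r : IntegralRep n) : IsElementaryReal r.value := by
  obtain ⟨E₁, E₂, h₁, h₂, f₁, f₂, hval⟩ := r.exists_value_eq_volume_sub
  rw [hval]
  exact (isElementaryReal_volume_of_isSemialgebraic h₁ f₁).sub
    (isElementaryReal_volume_of_isSemialgebraic h₂ f₂)

/-- **Every integral representation of the KZ calculus has a computable value.**
[cite: Yoshinaga2008, Thm. 18] -/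
theorem isComputableReal_value (r : IntegralRep n) : IsComputableReal r.value := by
  obtain ⟨E₁, E₂, h₁, h₂, f₁, f₂, hval⟩ := r.exists_value_eq_volume_sub
  rw [hval]
  exact (isComputableReal_volume_of_isSemialgebraic h₁ f₁).sub
    (isComputableReal_volume_of_isSemialgebraic h₂ f₂)

end KZ.IntegralRep

/-- **Yoshinaga's theorem** [Yoshinaga 2008, arXiv:0805.0349, Thm. 18 (Thm. 1.1 of the statement
file); Tent–Ziegler 2010, Cor. 1.2]: every real Kontsevich–Zagier period is an elementary real
number. Discharge of the named fact `isElementaryReal_of_isRealPeriod`. The printed proof reduces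
to volumes of bounded semialgebraic sets by Hironaka's rectilinearization (Lemma 24); this proof
instead writes the period as a difference of two finite (possibly unbounded) semialgebraic volumes,
grounds each to a down-set of the same volume, proves the polynomial tail decay of finite-volume
semialgebraic down-sets by an elementary argument (`DownSetTailDecay.lean`), and concludes by the
lattice-count exhaustion of `FiniteVolumeElementary.lean` (Yoshinaga §§3.3–3.6 localised to boxes).
[cite: Yoshinaga2008, Thm. 18] -/
theorem isElementaryReal_of_isRealPeriod_holds : isElementaryReal_of_isRealPeriod := by
  intro x hx
  obtain ⟨n, σ, p, q, hσ, hq, hint, rfl⟩ := hx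
  have := (KZ.IntegralRep.ofRational σ p q hσ hq hint).isElementaryReal_value
  rwa [KZ.IntegralRep.value_ofRational] at this

/-- **Yoshinaga's theorem, computable form** [Yoshinaga 2008, Thm. 18; Tent–Ziegler 2010]: every
real Kontsevich–Zagier period is a computable real number. Discharge of the named fact
`isComputableReal_of_isRealPeriod` (directly by the dyadic exhaustion of
`FiniteVolumeComputable.lean`; it also follows from the elementary form by
`isComputableReal_of_isRealPeriod_of_isElementaryReal`). [cite: Yoshinaga2008, Thm. 18] -/
theorem isComputableReal_of_isRealPeriod_holds : isComputableReal_of_isRealPeriod := by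
  intro x hx
  obtain ⟨n, σ, p, q, hσ, hq, hint, rfl⟩ := hx
  have := (KZ.IntegralRep.ofRational σ p q hσ hq hint).isComputableReal_value
  rwa [KZ.IntegralRep.value_ofRational] at this

/-- **Periods are computable complex numbers** [Yoshinaga 2008, Thm. 18, complex form]. Discharge
of the named fact `isComputableComplex_of_isPeriod`. [cite: Yoshinaga2008, Thm. 18 complex form] -/
theorem isComputableComplex_of_isPeriod_holds : isComputableComplex_of_isPeriod :=
  isComputableComplex_of_isPeriod_of_isComputableReal isComputableReal_of_isRealPeriod_holds

/-- **A computable real number which is not a period** [Yoshinaga 2008, §3.1, the corollary to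
Thm. 18: "So the real number `α` constructed above is not a period"]. Discharge of the named fact
`exists_isComputableReal_not_isRealPeriod`.
[cite: Yoshinaga2008, arXiv:0805.0349 §3.1 Thm. 18 and §2.3 Prop. 17] -/
theorem exists_isComputableReal_not_isRealPeriod_holds : exists_isComputableReal_not_isRealPeriod :=
  exists_isComputableReal_not_isRealPeriod_of_isElementaryReal_of_isRealPeriod
    isElementaryReal_of_isRealPeriod_holds

end Literature.NumberTheory.Transcendental
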